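/-
Literature file (hubbard-downfold lit-4 / hubbard-eph hydride packets): the Gor'kov–Kresin TWO-COUPLING-CONSTANT
description of superconductors whose phonon spectrum splits into an acoustic (heavy-ion) and an optical (hydrogen)
group — the weak-coupling geometric-mean law, the acoustic enhancement bracket of the strong-optical case, and the
exact isotope exponents both imply for substitution of the LIGHT ion only (H → D).
-/
import Mathlib.Analysis.SpecialFunctions.Pow.Real
import Mathlib.Analysis.SpecialFunctions.Pow.Deriv
import Mathlib.Analysis.SpecialFunctions.Log.Deriv
import Mathlib.Analysis.Real.Pi.Bounds
import Literature.MathematicalPhysics.QuantumManyBody.McMillanAllenDynes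
import Literature.MathematicalPhysics.QuantumManyBody.KresinStrongCouplingTc

/-!
# Two coupling constants (acoustic + optical): Gor'kov–Kresin `T_c` forms and their H → D isotope exponents

For hydrides (and other compounds with one light and one heavy ion) the Eliashberg function separates into an
acoustic group (`λ_ac`, `Ω̃_ac`, heavy ion) and an optical group (`λ_opt`, `Ω̃_opt`, hydrogen),
`λ_T = λ_opt + λ_ac` [KresinMorawitzWolf2013, §2.2.2 Eqs. (2.36)–(2.37); §3.5.3 Eqs. (3.86)–(3.87): `Ω_opt ∝
(γ/M_light)^{1/2}`, `Ω_ac` carried by the heavy ion]. Two printed `T_c` forms: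

* WEAK COUPLING (`T_c ≪ Ω̃_ac ≪ Ω̃_opt`), Grimvall:
  `T_c ≈ 0.25 Ω̃_opt^{λ_opt/λ_T} Ω̃_ac^{λ_ac/λ_T} exp(−(1 + λ_T)/(λ_T − μ*))` [ibid., Eq. (2.38)] — the prefactor is
  the `λ`-weighted GEOMETRIC mean of the two group frequencies, i.e. exactly `A2F.omegaLog` of the two-peak spectrum
  (`EliashbergSpectralMoments.lean`, `omegaLog_union`);
* STRONG OPTICAL COUPLING (`λ_opt ≫ λ_ac`, `λ_opt ≳ 1`):
  `T_c = [1 + 2 (λ_ac/(λ_opt − μ*)) / (1 + (π T_c⁰/Ω̃_ac)²)] · T_c⁰` [ibid., Eq. (2.39)], where `T_c⁰ = T_c^{opt}` is the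
  optical-only value from the McMillan–Dynes form [Eq. (2.40), `mcMillanTc Ω̃_opt λ_opt μ*`] or Kresin's form
  [Eq. (2.41), `kresinTcMu`].

PROVED here: (§1) the weak form is positive, monotone in both frequencies, and its prefactor is
`exp((λ_opt ln Ω̃_opt + λ_ac ln Ω̃_ac)/λ_T)`; **its light-ion isotope law is exact: `T_c(M₂)/T_c(M₁) =
(M₁/M₂)^{λ_opt/(2λ_T)}` for `Ω̃_opt = κ M^{−1/2}` at fixed `Ω̃_ac`, i.e. `α = ½ λ_opt/λ_T`** [ibid., Eq. (3.89)]
(also as the log-derivative `dT_c/dM = −(λ_opt/2λ_T) T_c/M`; `α = ¼` when `λ_opt = λ_ac` — the book's R3m-H₃S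
reading `α ≈ 0.25`, §7.2.6); (§2) the acoustic bracket `B = 1 + 2(λ_ac/(λ_opt − μ*))/(1 + (πT⁰/Ω̃_ac)²)`
satisfies `1 ≤ B ≤ 1 + 2λ_ac/(λ_opt − μ*)` (`λ_ac ≥ 0`, `μ* < λ_opt`) — the acoustic group NEVER LOWERS `T_c` and
adds at most the unretarded amount — is monotone in `λ_ac` and in `Ω̃_ac`, antitone in `T⁰`; `T_c = B·T⁰` is
monotone in `T⁰` whenever `λ_ac/(λ_opt − μ*) ≤ 4` (so the box → band rules of `mcMillanTc` / `kresinTcMu` compose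
with Eq. (2.39): `strongTcMcM_mono_opt`, `strongTcKresin_mono_opt`); (§3) **the exact light-ion isotope exponent
of Eq. (2.39)**: with `T⁰ ∝ M^{−1/2}` at fixed `Ω̃_ac`, `d ln T_c/d ln T⁰ = 1 − 2c x/((1 + x)(1 + x + c))`
(`strongTc_hasDerivAt`), `x = (πT⁰/Ω̃_ac)²`, `c = 2λ_ac/(λ_opt − μ*)`, so `α = ½ [1 − 2c x/((1 + x)(1 + x + c))]`
(`isotopeExp`); hence `α < ½` for any `c, x > 0`, `α ≥ 0` for `c ≤ 8`, and
`α ≥ ½[1 − 2c x/(1 + x)²] = ½[1 − 4(λ_ac/(λ_opt − μ*)) ρ²/(ρ² + 1)²]` (`ρ = Ω̃_ac/πT⁰`, `rho_form`) with gap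
`c²x/((1 + x)²(1 + x + c))` — Kresin's Eq. (3.90) is this lower bound with `μ*` dropped, i.e. the exact exponent
to first order in `λ_ac/λ_opt`; (§4) the book's H₃S (Im-3m) worked numbers `λ_opt = 1.5, λ_ac = 0.5,
Ω̃_ac = 450 K, T_c⁰ = 170 K` [ibid., §7.2.6] evaluated in the kernel with `3.14 < π < 3.15`: at `μ* = 0.1`,
`1.29 < B < 1.30` (so `T_c ∈ (219, 221) K`; book: «`ΔT_c^{ac} ≈ 45 K`», «`T_c ≈ 215 K`»), the exact exponent
`α ∈ (0.36, 0.37)`, and the printed Eq. (3.90) value `α ∈ (0.33, 0.34)` (book: «`α ≈ 0.35` is obtained»;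
measured `α = 0.35`, Drozdov et al. 2015 as quoted in §7.2.6).

WHAT IT IS NOT: a derivation of Eqs. (2.38)–(2.39) from the Eliashberg equation (they are typed as printed), a
statement about anharmonicity, polaronic effects or the `μ*(Ω̃_opt)` dependence (printed as further corrections to
`α`, the last «on the order of `(μ*/λ_opt)²`», §7.2.6), or a value of any parameter for any material.

## References
* [KresinMorawitzWolf2013] V. Z. Kresin, H. Morawitz, S. A. Wolf, Superconducting State (OUP): §2.2.2 «Critical
  temperature», Eqs. (2.36)–(2.41) (two phonon groups; Grimvall weak form; strong-optical form; `T_c⁰` by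
  McMillan–Dynes or by Eq. (2.33)); §3.5.3 «Multicomponent lattices and two coupling constants», Eqs. (3.86)–(3.90);
  §7.2.6 «Sulphur hydrides» (H₃S worked example: `λ_opt 1.5, λ_ac 0.5, Ω̃_opt ≈ 1700 K, Ω̃_ac ≈ 450 K,
  T_c⁰ = T_c^{opt} ≈ 170 K, ΔT_c^{ac} ≈ 45 K, T_c ≈ 215 K, α ≈ 0.35`; R3m: `λ_opt ≈ λ_ac ≈ 1`, Eq. (2.38) and
  `α ≈ 0.25` by Eq. (3.89)).
-/

noncomputable section

open Real Set

namespace Literature.MathematicalPhysics.QuantumManyBody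

namespace TwoCoupling

/-! ## §1 The weak-coupling two-group form, Eq. (2.38), and its exact isotope law (3.89) -/

/-- **Weak-coupling two-group `T_c`** (Grimvall / Gor'kov–Kresin):
`T_c = 0.25 Ω̃_opt^{λ_opt/λ_T} Ω̃_ac^{λ_ac/λ_T} exp(−(1 + λ_T)/(λ_T − μ*))`, `λ_T = λ_opt + λ_ac`.
[cite: KresinMorawitzWolf2013, Eq. (2.38)] -/
def weakTc (Ωopt Ωac lopt lac mu : ℝ) : ℝ :=
  0.25 * Ωopt ^ (lopt / (lopt + lac)) * Ωac ^ (lac / (lopt + lac)) *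
    Real.exp (-((1 + (lopt + lac)) / (lopt + lac - mu)))

/-- The two-group prefactor is the `λ`-weighted geometric mean written as an exponential of the weighted log —
the `ω_log` of the two-peak spectrum (cf. `A2F.omegaLog_union`). [cite: KresinMorawitzWolf2013, Eq. (2.38)] -/
theorem prefactor_eq_exp {Ωopt Ωac lopt lac : ℝ} (hΩo : 0 < Ωopt) (hΩa : 0 < Ωac) :
    Ωopt ^ (lopt / (lopt + lac)) * Ωac ^ (lac / (lopt + lac)) =
      Real.exp ((lopt * Real.log Ωopt + lac * Real.log Ωac) / (lopt + lac)) := by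
  rw [Real.rpow_def_of_pos hΩo, Real.rpow_def_of_pos hΩa, ← Real.exp_add]
  congr 1
  ring

/-- `T_c > 0` (positive frequencies). [cite: KresinMorawitzWolf2013, Eq. (2.38)] -/
theorem weakTc_pos {Ωopt Ωac lopt lac mu : ℝ} (hΩo : 0 < Ωopt) (hΩa : 0 < Ωac) :
    0 < weakTc Ωopt Ωac lopt lac mu := by
  unfold weakTc
  have h1 : 0 < Ωopt ^ (lopt / (lopt + lac)) := Real.rpow_pos_of_pos hΩo _
  have h2 : 0 < Ωac ^ (lac / (lopt + lac)) := Real.rpow_pos_of_pos hΩa _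
  positivity

/-- **Monotone in `Ω̃_opt`** (`λ_opt ≥ 0`, `λ_T > 0`). [cite: KresinMorawitzWolf2013, Eq. (2.38)] -/
theorem weakTc_mono_opt {Ω₁ Ω₂ Ωac lopt lac mu : ℝ} (hΩ₁ : 0 ≤ Ω₁) (h : Ω₁ ≤ Ω₂) (hΩa : 0 ≤ Ωac)
    (hlo : 0 ≤ lopt) (hT : 0 < lopt + lac) :
    weakTc Ω₁ Ωac lopt lac mu ≤ weakTc Ω₂ Ωac lopt lac mu := by
  unfold weakTc
  have hp : 0 ≤ lopt / (lopt + lac) := div_nonneg hlo hT.le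
  have hr : Ω₁ ^ (lopt / (lopt + lac)) ≤ Ω₂ ^ (lopt / (lopt + lac)) := Real.rpow_le_rpow hΩ₁ h hp
  have h2 : 0 ≤ Ωac ^ (lac / (lopt + lac)) := Real.rpow_nonneg hΩa _
  have hE : 0 ≤ Real.exp (-((1 + (lopt + lac)) / (lopt + lac - mu))) := (Real.exp_pos _).le
  have := mul_le_mul_of_nonneg_right (mul_le_mul_of_nonneg_right
    (mul_le_mul_of_nonneg_left hr (by norm_num : (0:ℝ) ≤ 0.25)) h2) hE
  simpa [mul_assoc] using this

/-- **Monotone in `Ω̃_ac`** (`λ_ac ≥ 0`, `λ_T > 0`). [cite: KresinMorawitzWolf2013, Eq. (2.38)] -/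
theorem weakTc_mono_ac {Ωopt Ω₁ Ω₂ lopt lac mu : ℝ} (hΩo : 0 ≤ Ωopt) (hΩ₁ : 0 ≤ Ω₁) (h : Ω₁ ≤ Ω₂)
    (hla : 0 ≤ lac) (hT : 0 < lopt + lac) :
    weakTc Ωopt Ω₁ lopt lac mu ≤ weakTc Ωopt Ω₂ lopt lac mu := by
  unfold weakTc
  have hp : 0 ≤ lac / (lopt + lac) := div_nonneg hla hT.le
  have hr : Ω₁ ^ (lac / (lopt + lac)) ≤ Ω₂ ^ (lac / (lopt + lac)) := Real.rpow_le_rpow hΩ₁ h hp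
  have h1 : 0 ≤ 0.25 * Ωopt ^ (lopt / (lopt + lac)) := by
    have := Real.rpow_nonneg hΩo (lopt / (lopt + lac)); positivity
  have hE : 0 ≤ Real.exp (-((1 + (lopt + lac)) / (lopt + lac - mu))) := (Real.exp_pos _).le
  exact mul_le_mul_of_nonneg_right (mul_le_mul_of_nonneg_left hr h1) hE

/-- **The exact light-ion isotope law of the weak form.** With `Ω̃_opt = κ M^{−1/2}` (only the LIGHT ion
substituted; `Ω̃_ac` fixed), `T_c(M₂)/T_c(M₁) = (M₁/M₂)^{λ_opt/(2λ_T)}` — isotope exponent `α = ½ λ_opt/λ_T`.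
[cite: KresinMorawitzWolf2013, Eq. (3.89)] -/
theorem weakTc_isotope_ratio {κ Ωac lopt lac mu M₁ M₂ : ℝ} (hκ : 0 < κ) (hΩa : 0 < Ωac) (hM₁ : 0 < M₁)
    (hM₂ : 0 < M₂) :
    weakTc (κ * M₂ ^ (-(1:ℝ) / 2)) Ωac lopt lac mu / weakTc (κ * M₁ ^ (-(1:ℝ) / 2)) Ωac lopt lac mu =
      (M₁ / M₂) ^ (lopt / (2 * (lopt + lac))) := by
  unfold weakTc
  set p := lopt / (lopt + lac) with hp
  have hM₁' : 0 < M₁ ^ (-(1:ℝ) / 2) := Real.rpow_pos_of_pos hM₁ _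
  have hM₂' : 0 < M₂ ^ (-(1:ℝ) / 2) := Real.rpow_pos_of_pos hM₂ _
  have hA : 0 < Ωac ^ (lac / (lopt + lac)) := Real.rpow_pos_of_pos hΩa _
  have hE : 0 < Real.exp (-((1 + (lopt + lac)) / (lopt + lac - mu))) := Real.exp_pos _
  have hκp : 0 < κ ^ p := Real.rpow_pos_of_pos hκ _
  rw [Real.mul_rpow hκ.le hM₂'.le, Real.mul_rpow hκ.le hM₁'.le, ← Real.rpow_mul hM₂.le, ← Real.rpow_mul hM₁.le]
  have hexp : -(1:ℝ) / 2 * p = -(lopt / (2 * (lopt + lac))) := by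
    rw [hp, div_eq_mul_inv lopt (2 * (lopt + lac)), mul_inv]; ring
  rw [hexp, Real.rpow_neg hM₂.le, Real.rpow_neg hM₁.le, Real.div_rpow hM₁.le hM₂.le]
  have h1 : 0 < M₁ ^ (lopt / (2 * (lopt + lac))) := Real.rpow_pos_of_pos hM₁ _
  have h2 : 0 < M₂ ^ (lopt / (2 * (lopt + lac))) := Real.rpow_pos_of_pos hM₂ _
  field_simp

/-- **`α = ½ · λ_opt/λ_T` as a logarithmic derivative**: with `Ω̃_opt = κ M^{−1/2}` the map `M ↦ T_c` has
`dT_c/dM = −(λ_opt/(2λ_T)) · T_c/M`. [cite: KresinMorawitzWolf2013, Eq. (3.89)] -/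
theorem weakTc_isotope_hasDerivAt {κ Ωac lopt lac mu M : ℝ} (hκ : 0 < κ) (hM : 0 < M) :
    HasDerivAt (fun m : ℝ => weakTc (κ * m ^ (-(1:ℝ) / 2)) Ωac lopt lac mu)
      (-(lopt / (2 * (lopt + lac))) * weakTc (κ * M ^ (-(1:ℝ) / 2)) Ωac lopt lac mu / M) M := by
  unfold weakTc
  set p := lopt / (lopt + lac) with hp
  set C := Ωac ^ (lac / (lopt + lac)) * Real.exp (-((1 + (lopt + lac)) / (lopt + lac - mu))) with hC
  -- (κ m^{-1/2})^p = κ^p · m^{-p/2} for m > 0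
  have key : ∀ m : ℝ, 0 < m → (κ * m ^ (-(1:ℝ) / 2)) ^ p = κ ^ p * m ^ (-(p / 2)) := by
    intro m hm
    rw [Real.mul_rpow hκ.le (Real.rpow_pos_of_pos hm _).le, ← Real.rpow_mul hm.le,
      show -(1:ℝ) / 2 * p = -(p / 2) by ring]
  have hderiv : HasDerivAt (fun m : ℝ => κ ^ p * m ^ (-(p / 2)))
      (κ ^ p * (-(p / 2) * M ^ (-(p / 2) - 1))) M :=
    (Real.hasDerivAt_rpow_const (Or.inl hM.ne')).const_mul (κ ^ p)
  have hfun : (fun m : ℝ => 0.25 * (κ * m ^ (-(1:ℝ) / 2)) ^ p * Ωac ^ (lac / (lopt + lac)) *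
      Real.exp (-((1 + (lopt + lac)) / (lopt + lac - mu)))) =ᶠ[nhds M]
      (fun m : ℝ => 0.25 * C * (κ ^ p * m ^ (-(p / 2)))) := by
    filter_upwards [lt_mem_nhds hM] with m hm
    rw [key m hm, hC]; ring
  have h2 := (hderiv.const_mul (0.25 * C)).congr_of_eventuallyEq hfun
  refine h2.congr_deriv ?_
  have hM' : M ^ (-(p / 2) - 1) = M ^ (-(p / 2)) / M := by rw [Real.rpow_sub_one hM.ne']
  have hexp2 : lopt / (2 * (lopt + lac)) = p / 2 := by rw [hp, div_div, mul_comm]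
  rw [key M hM, hM', hC, hexp2]
  ring

/-! ## §2 The acoustic bracket of Eq. (2.39) -/

/-- The ratio `c = 2λ_ac/(λ_opt − μ*)` entering the bracket. [cite: KresinMorawitzWolf2013, Eq. (2.39)] -/
def cRatio (lopt lac mu : ℝ) : ℝ := 2 * (lac / (lopt - mu))

/-- **The acoustic enhancement bracket** `B = 1 + 2(λ_ac/(λ_opt − μ*)) / (1 + (π T⁰/Ω̃_ac)²)`.
[cite: KresinMorawitzWolf2013, Eq. (2.39)] -/
def bracket (lopt lac mu Ωac T0 : ℝ) : ℝ :=
  1 + cRatio lopt lac mu / (1 + (Real.pi * T0 / Ωac) ^ 2)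

/-- **Eq. (2.39)**: `T_c = B · T_c⁰`, with `T_c⁰ = T_c^{opt}` the optical-only value (Eq. (2.40): `mcMillanTc
Ω̃_opt λ_opt μ*` for `λ_opt ≲ 1.5`; Eq. (2.41): Kresin's form for larger `λ_opt`).
[cite: KresinMorawitzWolf2013, Eq. (2.39)] -/
def strongTc (lopt lac mu Ωac T0 : ℝ) : ℝ := bracket lopt lac mu Ωac T0 * T0

/-- Eq. (2.39) with `T_c⁰` taken from the McMillan–Dynes form, Eq. (2.40).
[cite: KresinMorawitzWolf2013, Eq. (2.40)] -/
def strongTcMcM (Ωopt Ωac lopt lac mu : ℝ) : ℝ :=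
  strongTc lopt lac mu Ωac (mcMillanTc Ωopt lopt mu)

/-- `c ≥ 0` for `λ_ac ≥ 0`, `μ* < λ_opt`. [cite: KresinMorawitzWolf2013, Eq. (2.39)] -/
theorem cRatio_nonneg {lopt lac mu : ℝ} (hla : 0 ≤ lac) (hmu : mu < lopt) : 0 ≤ cRatio lopt lac mu := by
  unfold cRatio; exact mul_nonneg (by norm_num) (div_nonneg hla (by linarith))

/-- **The acoustic group never lowers `T_c`**: `B ≥ 1`. [cite: KresinMorawitzWolf2013, Eq. (2.39)] -/
theorem one_le_bracket {lopt lac mu Ωac T0 : ℝ} (hla : 0 ≤ lac) (hmu : mu < lopt) :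
    1 ≤ bracket lopt lac mu Ωac T0 := by
  unfold bracket
  have := div_nonneg (cRatio_nonneg hla hmu) (by positivity : (0:ℝ) ≤ 1 + (Real.pi * T0 / Ωac) ^ 2)
  linarith

/-- **… and adds at most the unretarded amount**: `B ≤ 1 + 2λ_ac/(λ_opt − μ*)` (the retardation denominator
`1 + (πT⁰/Ω̃_ac)² ≥ 1`). [cite: KresinMorawitzWolf2013, Eq. (2.39)] -/
theorem bracket_le {lopt lac mu Ωac T0 : ℝ} (hla : 0 ≤ lac) (hmu : mu < lopt) :
    bracket lopt lac mu Ωac T0 ≤ 1 + cRatio lopt lac mu := by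
  unfold bracket
  have hc := cRatio_nonneg hla hmu (lopt := lopt)
  have hD : 1 ≤ 1 + (Real.pi * T0 / Ωac) ^ 2 := by nlinarith [sq_nonneg (Real.pi * T0 / Ωac)]
  have := div_le_self hc hD
  linarith

/-- **`T_c ≥ T_c⁰`** (`T⁰ ≥ 0`). [cite: KresinMorawitzWolf2013, Eq. (2.39)] -/
theorem le_strongTc {lopt lac mu Ωac T0 : ℝ} (hla : 0 ≤ lac) (hmu : mu < lopt) (hT : 0 ≤ T0) :
    T0 ≤ strongTc lopt lac mu Ωac T0 := by
  unfold strongTc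
  have := one_le_bracket (Ωac := Ωac) (T0 := T0) hla hmu
  nlinarith

/-- **`T_c ≤ (1 + 2λ_ac/(λ_opt − μ*)) T_c⁰`**. [cite: KresinMorawitzWolf2013, Eq. (2.39)] -/
theorem strongTc_le {lopt lac mu Ωac T0 : ℝ} (hla : 0 ≤ lac) (hmu : mu < lopt) (hT : 0 ≤ T0) :
    strongTc lopt lac mu Ωac T0 ≤ (1 + cRatio lopt lac mu) * T0 := by
  unfold strongTc
  exact mul_le_mul_of_nonneg_right (bracket_le hla hmu) hT

/-- **`B` is monotone in `λ_ac`**. [cite: KresinMorawitzWolf2013, Eq. (2.39)] -/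
theorem bracket_mono_lac {lopt l₁ l₂ mu Ωac T0 : ℝ} (hmu : mu < lopt) (h : l₁ ≤ l₂) :
    bracket lopt l₁ mu Ωac T0 ≤ bracket lopt l₂ mu Ωac T0 := by
  unfold bracket cRatio
  have hD : 0 < 1 + (Real.pi * T0 / Ωac) ^ 2 := by positivity
  have hlo : 0 < lopt - mu := by linarith
  have : 2 * (l₁ / (lopt - mu)) ≤ 2 * (l₂ / (lopt - mu)) := by
    have := div_le_div_of_nonneg_right h hlo.le; linarith
  have := div_le_div_of_nonneg_right this hD.le
  linarith

/-- **`B` is monotone in `Ω̃_ac`** (`T⁰ ≥ 0`, `Ω̃_ac > 0`): a stiffer heavy-ion group is less retarded.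
[cite: KresinMorawitzWolf2013, Eq. (2.39)] -/
theorem bracket_mono_Ωac {lopt lac mu Ω₁ Ω₂ T0 : ℝ} (hla : 0 ≤ lac) (hmu : mu < lopt) (hT : 0 ≤ T0)
    (hΩ₁ : 0 < Ω₁) (h : Ω₁ ≤ Ω₂) : bracket lopt lac mu Ω₁ T0 ≤ bracket lopt lac mu Ω₂ T0 := by
  unfold bracket
  have hc := cRatio_nonneg hla hmu (lopt := lopt)
  have hΩ₂ : 0 < Ω₂ := lt_of_lt_of_le hΩ₁ h
  have hx : Real.pi * T0 / Ω₂ ≤ Real.pi * T0 / Ω₁ :=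
    div_le_div_of_nonneg_left (by positivity) hΩ₁ h
  have hx0 : 0 ≤ Real.pi * T0 / Ω₂ := by positivity
  have hsq : (Real.pi * T0 / Ω₂) ^ 2 ≤ (Real.pi * T0 / Ω₁) ^ 2 := pow_le_pow_left₀ hx0 hx 2
  have hD₂ : 0 < 1 + (Real.pi * T0 / Ω₂) ^ 2 := by positivity
  have := div_le_div_of_nonneg_left hc hD₂ (by linarith : 1 + (Real.pi * T0 / Ω₂) ^ 2 ≤ 1 + (Real.pi * T0 / Ω₁) ^ 2)
  linarith

/-- **`B` is antitone in `T⁰`** (`T⁰ ≥ 0`): the retardation cut grows with `T_c⁰/Ω̃_ac`.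
[cite: KresinMorawitzWolf2013, Eq. (2.39)] -/
theorem bracket_anti_T0 {lopt lac mu Ωac T₁ T₂ : ℝ} (hla : 0 ≤ lac) (hmu : mu < lopt) (hΩ : 0 < Ωac)
    (hT₁ : 0 ≤ T₁) (h : T₁ ≤ T₂) : bracket lopt lac mu Ωac T₂ ≤ bracket lopt lac mu Ωac T₁ := by
  unfold bracket
  have hc := cRatio_nonneg hla hmu (lopt := lopt)
  have hx : Real.pi * T₁ / Ωac ≤ Real.pi * T₂ / Ωac :=
    div_le_div_of_nonneg_right (mul_le_mul_of_nonneg_left h Real.pi_pos.le) hΩ.le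
  have hx0 : 0 ≤ Real.pi * T₁ / Ωac := by positivity
  have hsq : (Real.pi * T₁ / Ωac) ^ 2 ≤ (Real.pi * T₂ / Ωac) ^ 2 := pow_le_pow_left₀ hx0 hx 2
  have hD₁ : 0 < 1 + (Real.pi * T₁ / Ωac) ^ 2 := by positivity
  have := div_le_div_of_nonneg_left hc hD₁ (by linarith : 1 + (Real.pi * T₁ / Ωac) ^ 2 ≤ 1 + (Real.pi * T₂ / Ωac) ^ 2)
  linarith

/-- Algebraic core of the `T⁰`-monotonicity: for `0 ≤ c ≤ 8`, `a ≥ 0` and `0 ≤ T₁ ≤ T₂`,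
`T₁(1 + c/(1 + aT₁²)) ≤ T₂(1 + c/(1 + aT₂²))`. [folklore] -/
private theorem mono_core {c a T₁ T₂ : ℝ} (hc : 0 ≤ c) (hc8 : c ≤ 8) (ha : 0 ≤ a) (hT₁ : 0 ≤ T₁)
    (h : T₁ ≤ T₂) : T₁ * (1 + c / (1 + a * T₁ ^ 2)) ≤ T₂ * (1 + c / (1 + a * T₂ ^ 2)) := by
  have hD₁ : 0 < 1 + a * T₁ ^ 2 := by positivity
  have hT₂ : 0 ≤ T₂ := hT₁.trans h
  have hD₂ : 0 < 1 + a * T₂ ^ 2 := by positivity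
  rw [mul_add, mul_add, mul_one, mul_one, mul_div_assoc', mul_div_assoc']
  rw [← sub_nonneg]
  have key : T₂ + T₂ * c / (1 + a * T₂ ^ 2) - (T₁ + T₁ * c / (1 + a * T₁ ^ 2)) =
      (T₂ - T₁) * (((1 + a * T₁ ^ 2) * (1 + a * T₂ ^ 2) + c * (1 - a * T₁ * T₂)) /
        ((1 + a * T₁ ^ 2) * (1 + a * T₂ ^ 2))) := by
    field_simp
    ring
  rw [key]
  apply mul_nonneg (sub_nonneg.2 h)
  apply div_nonneg _ (by positivity)
  -- (1 + p)(1 + q) ≥ (1 + s)² with s = a T₁ T₂ (AM–GM on a T₁², a T₂²), and (1+s)² ≥ 8(s−1) ≥ c(s−1)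
  set s := a * T₁ * T₂ with hs
  have hs0 : 0 ≤ s := by positivity
  have h1 : (1 + s) ^ 2 ≤ (1 + a * T₁ ^ 2) * (1 + a * T₂ ^ 2) := by
    have : 2 * s ≤ a * T₁ ^ 2 + a * T₂ ^ 2 := by
      rw [hs]; nlinarith [sq_nonneg (T₁ - T₂), ha]
    nlinarith [sq_nonneg s]
  have h2 : c * (s - 1) ≤ (1 + s) ^ 2 := by
    rcases le_or_gt s 1 with hs1 | hs1
    · nlinarith
    · nlinarith [sq_nonneg (s - 3)]
  nlinarith

/-- **`T_c = B·T⁰` is monotone in `T⁰`** whenever `λ_ac/(λ_opt − μ*) ≤ 4` (`c ≤ 8`; amply true in the printed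
regime `λ_opt ≫ λ_ac`): the shrinking bracket never outweighs the growing `T⁰`. This is what lets the box → band
rule of the `T⁰` form (McMillan / Kresin) compose with Eq. (2.39). [cite: KresinMorawitzWolf2013, Eq. (2.39)] -/
theorem strongTc_mono_T0 {lopt lac mu Ωac T₁ T₂ : ℝ} (hla : 0 ≤ lac) (hmu : mu < lopt)
    (hc8 : lac / (lopt - mu) ≤ 4) (hT₁ : 0 ≤ T₁) (h : T₁ ≤ T₂) :
    strongTc lopt lac mu Ωac T₁ ≤ strongTc lopt lac mu Ωac T₂ := by
  unfold strongTc bracket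
  have hc := cRatio_nonneg hla hmu (lopt := lopt)
  have hc8' : cRatio lopt lac mu ≤ 8 := by unfold cRatio; linarith
  have e : ∀ T : ℝ, (Real.pi * T / Ωac) ^ 2 = (Real.pi / Ωac) ^ 2 * T ^ 2 := fun T => by ring
  rw [e T₁, e T₂, mul_comm (1 + _) T₁, mul_comm (1 + _) T₂]
  exact mono_core hc hc8' (sq_nonneg _) hT₁ h

/-- **Composition with the McMillan–Dynes `T⁰` (Eq. (2.40)): monotone in `Ω̃_opt`.**
[cite: KresinMorawitzWolf2013, Eq. (2.40)] -/
theorem strongTcMcM_mono_opt {Ω₁ Ω₂ Ωac lopt lac mu : ℝ} (hla : 0 ≤ lac) (hmu : mu < lopt)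
    (hc8 : lac / (lopt - mu) ≤ 4) (hΩ₁ : 0 ≤ Ω₁) (h : Ω₁ ≤ Ω₂) :
    strongTcMcM Ω₁ Ωac lopt lac mu ≤ strongTcMcM Ω₂ Ωac lopt lac mu :=
  strongTc_mono_T0 hla hmu hc8 (mcMillanTc_nonneg lopt mu hΩ₁) (mcMillanTc_mono_omega lopt mu h)

/-- **`T_c ≥ T_c^{McM}(Ω̃_opt, λ_opt, μ*)`** for the composed form. [cite: KresinMorawitzWolf2013, Eq. (2.39)] -/
theorem mcMillanTc_le_strongTcMcM {Ωopt Ωac lopt lac mu : ℝ} (hla : 0 ≤ lac) (hmu : mu < lopt)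
    (hΩo : 0 ≤ Ωopt) : mcMillanTc Ωopt lopt mu ≤ strongTcMcM Ωopt Ωac lopt lac mu :=
  le_strongTc hla hmu (mcMillanTc_nonneg lopt mu hΩo)

/-- Eq. (2.39) with `T_c⁰` taken from Kresin's arbitrary-coupling form, Eq. (2.41) (for `λ_opt > 1.5`).
[cite: KresinMorawitzWolf2013, Eq. (2.41)] -/
def strongTcKresin (Ωopt Ωac lopt lac mu : ℝ) : ℝ :=
  strongTc lopt lac mu Ωac (kresinTcMu Ωopt lopt mu)

/-- **Composition with Kresin's `T⁰` (Eq. (2.41)): monotone in `Ω̃_opt`.** [cite: KresinMorawitzWolf2013, Eq. (2.41)] -/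
theorem strongTcKresin_mono_opt {Ω₁ Ω₂ Ωac lopt lac mu : ℝ} (hla : 0 ≤ lac) (hmu : mu < lopt)
    (hc8 : lac / (lopt - mu) ≤ 4) (hΩ₁ : 0 ≤ Ω₁) (h : Ω₁ ≤ Ω₂) :
    strongTcKresin Ω₁ Ωac lopt lac mu ≤ strongTcKresin Ω₂ Ωac lopt lac mu :=
  strongTc_mono_T0 hla hmu hc8 (kresinTc_nonneg (kresinLambdaEff lopt mu) hΩ₁) (kresinTcMu_mono_omega lopt mu h)

/-- **`T_c ≥ T_c^{Kresin}(Ω̃_opt, λ_opt, μ*)`** for the composed form. [cite: KresinMorawitzWolf2013, Eq. (2.39)] -/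
theorem kresinTcMu_le_strongTcKresin {Ωopt Ωac lopt lac mu : ℝ} (hla : 0 ≤ lac) (hmu : mu < lopt)
    (hΩo : 0 ≤ Ωopt) : kresinTcMu Ωopt lopt mu ≤ strongTcKresin Ωopt Ωac lopt lac mu :=
  le_strongTc hla hmu (kresinTc_nonneg (kresinLambdaEff lopt mu) hΩo)

/-! ## §3 The exact light-ion isotope exponent of Eq. (2.39) and Kresin's Eq. (3.90) -/

/-- The exact isotope exponent of Eq. (2.39) under `T⁰ ∝ M^{−1/2}` at fixed `Ω̃_ac`:
`α = ½ [1 − 2c x/((1 + x)(1 + x + c))]`, `x = (πT⁰/Ω̃_ac)²`, `c = 2λ_ac/(λ_opt − μ*)`.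
[cite: KresinMorawitzWolf2013, Eq. (3.90)] -/
def isotopeExp (c x : ℝ) : ℝ := (1 / 2) * (1 - 2 * c * x / ((1 + x) * (1 + x + c)))

/-- Kresin's printed first-order form `α = ½[1 − 4(λ_ac/λ_opt) ρ²/(ρ² + 1)²]`, `ρ = Ω̃_ac/πT⁰`, written with
`x = 1/ρ²` and `c = 2λ_ac/λ_opt` (so `4 λ_ac/λ_opt · ρ²/(ρ²+1)² = 2c·x/(1+x)²`).
[cite: KresinMorawitzWolf2013, Eq. (3.90)] -/
def kresinIsotope (c x : ℝ) : ℝ := (1 / 2) * (1 - 2 * c * x / (1 + x) ^ 2)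

/-- `ρ²/(ρ² + 1)² = x/(1 + x)²` with `x = 1/ρ²` — the two ways of writing the retardation factor agree.
[cite: KresinMorawitzWolf2013, Eq. (3.90)] -/
theorem rho_form {ρ : ℝ} (hρ : 0 < ρ) : ρ ^ 2 / (ρ ^ 2 + 1) ^ 2 = (1 / ρ ^ 2) / (1 + 1 / ρ ^ 2) ^ 2 := by
  have : ρ ^ 2 ≠ 0 := by positivity
  field_simp

/-- **The logarithmic derivative of Eq. (2.39) in `T⁰`**: `d ln T_c / d ln T⁰ = 1 − 2c x/((1+x)(1+x+c))`
(as a `HasDerivAt` statement for `T⁰ ↦ B(T⁰)·T⁰`). [cite: KresinMorawitzWolf2013, Eq. (2.39)] -/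
theorem strongTc_hasDerivAt {lopt lac mu Ωac T0 : ℝ} (hla : 0 ≤ lac) (hmu : mu < lopt) (hT : 0 < T0) :
    HasDerivAt (fun t => strongTc lopt lac mu Ωac t)
      (2 * isotopeExp (cRatio lopt lac mu) ((Real.pi * T0 / Ωac) ^ 2) *
        (strongTc lopt lac mu Ωac T0 / T0)) T0 := by
  unfold strongTc bracket isotopeExp
  set c := cRatio lopt lac mu with hc_def
  have hc : 0 ≤ c := by rw [hc_def]; exact cRatio_nonneg hla hmu
  set a := (Real.pi / Ωac) ^ 2 with ha
  have ha0 : 0 ≤ a := by rw [ha]; exact sq_nonneg _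
  have e : ∀ t : ℝ, (Real.pi * t / Ωac) ^ 2 = a * t ^ 2 := fun t => by rw [ha]; ring
  simp only [e]
  have hD : ∀ t : ℝ, 0 < 1 + a * t ^ 2 := fun t => by positivity
  -- derivative of t ↦ (1 + c/(1 + a t²)) t by the quotient and product rules
  have h1 : HasDerivAt (fun t : ℝ => 1 + a * t ^ 2) (a * (2 * T0)) T0 := by
    have := ((hasDerivAt_pow 2 T0).const_mul a).const_add 1
    simpa using this
  have h2 : HasDerivAt (fun t : ℝ => c / (1 + a * t ^ 2))
      ((0 * (1 + a * T0 ^ 2) - c * (a * (2 * T0))) / (1 + a * T0 ^ 2) ^ 2) T0 :=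
    (hasDerivAt_const T0 c).fun_div h1 (hD T0).ne'
  have h3 : HasDerivAt (fun t : ℝ => (1 + c / (1 + a * t ^ 2)) * t)
      ((0 * (1 + a * T0 ^ 2) - c * (a * (2 * T0))) / (1 + a * T0 ^ 2) ^ 2 * T0 +
        (1 + c / (1 + a * T0 ^ 2)) * 1) T0 :=
    (h2.const_add 1).fun_mul (hasDerivAt_id' (x := T0))
  refine h3.congr_deriv ?_
  have hD0 := (hD T0).ne'
  have hT0 := hT.ne'
  have hE : (1 + a * T0 ^ 2 + c) ≠ 0 := by have := hD T0; positivity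
  field_simp
  ring

/-- **`α < ½`**: any acoustic admixture (`c > 0`) lowers the light-ion isotope exponent below the harmonic
single-group value `½` (`x > 0`). [cite: KresinMorawitzWolf2013, Eq. (3.90)] -/
theorem isotopeExp_lt_half {c x : ℝ} (hc : 0 < c) (hx : 0 < x) : isotopeExp c x < 1 / 2 := by
  unfold isotopeExp
  have : 0 < 2 * c * x / ((1 + x) * (1 + x + c)) := by positivity
  linarith

/-- **`α ≥ 0`** whenever `c ≤ 8` (i.e. `λ_ac/(λ_opt − μ*) ≤ 4`): `2cx ≤ (1+x)(1+x+c)`, with equality only at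
`c = 8, x = 3` — the normal-sign light-ion isotope effect survives any admissible acoustic admixture.
[cite: KresinMorawitzWolf2013, Eq. (3.90)] -/
theorem isotopeExp_nonneg {c x : ℝ} (hc : 0 ≤ c) (hc8 : c ≤ 8) (hx : 0 ≤ x) : 0 ≤ isotopeExp c x := by
  unfold isotopeExp
  have hD : 0 < (1 + x) * (1 + x + c) := by positivity
  -- (1+x)(1+x+c) − 2cx = (1+x)² + c(1−x); if x ≤ 1 this is ≥ (1+x)², else ≥ (1+x)² − 8(x−1) = (x−3)²
  have hle : 2 * c * x ≤ (1 + x) * (1 + x + c) := by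
    rcases le_or_gt x 1 with hx1 | hx1
    · nlinarith [mul_nonneg hc (sub_nonneg.2 hx1)]
    · nlinarith [mul_nonneg (sub_nonneg.2 hc8) (sub_nonneg.2 hx1.le), sq_nonneg (x - 3)]
  have : 2 * c * x / ((1 + x) * (1 + x + c)) ≤ 1 := by rw [div_le_one hD]; exact hle
  linarith

/-- **`α > 0`** when `c < 8`. [cite: KresinMorawitzWolf2013, Eq. (3.90)] -/
theorem isotopeExp_pos {c x : ℝ} (hc : 0 ≤ c) (hc8 : c < 8) (hx : 0 ≤ x) : 0 < isotopeExp c x := by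
  unfold isotopeExp
  have hD : 0 < (1 + x) * (1 + x + c) := by positivity
  have hlt : 2 * c * x < (1 + x) * (1 + x + c) := by
    rcases le_or_gt x 1 with hx1 | hx1
    · nlinarith [mul_nonneg hc (sub_nonneg.2 hx1)]
    · nlinarith [mul_pos (sub_pos.2 hc8) (sub_pos.2 hx1), sq_nonneg (x - 3)]
  have : 2 * c * x / ((1 + x) * (1 + x + c)) < 1 := by rw [div_lt_one hD]; exact hlt
  linarith

/-- **Kresin's Eq. (3.90) is a LOWER bound of the exact exponent** (equal to first order in `c`):
`½[1 − 2cx/(1+x)²] ≤ ½[1 − 2cx/((1+x)(1+x+c))]` for `c, x ≥ 0`. [cite: KresinMorawitzWolf2013, Eq. (3.90)] -/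
theorem kresinIsotope_le_isotopeExp {c x : ℝ} (hc : 0 ≤ c) (hx : 0 ≤ x) :
    kresinIsotope c x ≤ isotopeExp c x := by
  unfold kresinIsotope isotopeExp
  have hD1 : 0 < (1 + x) ^ 2 := by positivity
  have hD2 : 0 < (1 + x) * (1 + x + c) := by positivity
  have hnum : 0 ≤ 2 * c * x := by positivity
  have : 2 * c * x / ((1 + x) * (1 + x + c)) ≤ 2 * c * x / (1 + x) ^ 2 :=
    div_le_div_of_nonneg_left hnum hD1 (by nlinarith)
  linarith

/-- The gap between the exact exponent and Eq. (3.90) is second order: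
`isotopeExp − kresinIsotope = c²x/((1+x)²(1+x+c))`. [cite: KresinMorawitzWolf2013, Eq. (3.90)] -/
theorem isotopeExp_sub_kresinIsotope {c x : ℝ} (hc : 0 ≤ c) (hx : 0 ≤ x) :
    isotopeExp c x - kresinIsotope c x = c ^ 2 * x / ((1 + x) ^ 2 * (1 + x + c)) := by
  unfold isotopeExp kresinIsotope
  have h1 : (1 + x) ≠ 0 := by positivity
  have h2 : (1 + x + c) ≠ 0 := by positivity
  field_simp
  ring

/-! ## §4 The printed H₃S (Im-3m) numbers evaluated in the kernel -/

/-- The book's H₃S inputs `λ_opt = 1.5, λ_ac = 0.5, Ω̃_ac = 450 K, T_c⁰ = 170 K` with `μ* = 0.1` give an acoustic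
bracket `1.29 < B < 1.30`, i.e. `T_c = B·T_c⁰ ∈ (219 K, 221 K)` (book: «`ΔT_c^{ac} ≈ 45 K`», «`T_c ≈ 215 K`» after
«a simple calculation», `μ*` not restated). [cite: KresinMorawitzWolf2013, §7.2.6] -/
theorem h3s_bracket_bounds :
    1.29 < bracket 1.5 0.5 0.1 450 170 ∧ bracket 1.5 0.5 0.1 450 170 < 1.30 := by
  unfold bracket cRatio
  have hπ1 := Real.pi_gt_d2
  have hπ2 := Real.pi_lt_d2
  have hx1 : 1.40 < (Real.pi * 170 / 450) ^ 2 := by nlinarith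
  have hx2 : (Real.pi * 170 / 450) ^ 2 < 1.42 := by nlinarith
  have hc : (2 : ℝ) * (0.5 / (1.5 - 0.1)) = 1 / 1.4 := by norm_num
  rw [hc]
  constructor
  · have : 1 / 1.4 / (1 + 1.42) < 1 / 1.4 / (1 + (Real.pi * 170 / 450) ^ 2) :=
      div_lt_div_of_pos_left (by norm_num) (by positivity) (by linarith)
    have h0 : (0.29 : ℝ) < 1 / 1.4 / (1 + 1.42) := by norm_num
    linarith
  · have : 1 / 1.4 / (1 + (Real.pi * 170 / 450) ^ 2) < 1 / 1.4 / (1 + 1.40) :=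
      div_lt_div_of_pos_left (by norm_num) (by positivity) (by linarith)
    have h0 : 1 / 1.4 / (1 + 1.40) < (0.30 : ℝ) := by norm_num
    linarith

/-- With the same inputs (`x = (π·170/450)² ∈ (1.40, 1.42)`): the EXACT light-ion isotope exponent of Eq. (2.39)
(`c = 2·0.5/(1.5 − 0.1) = 1/1.4`) lies in `(0.36, 0.37)`, and Kresin's printed first-order Eq. (3.90)
(`4λ_ac/λ_opt`, no `μ*`: `c = 2/3`) in `(0.33, 0.34)` — book: «`α ≈ 0.35` is obtained»; measured `α = 0.35`
(Drozdov et al. 2015, as quoted ibid.). [cite: KresinMorawitzWolf2013, §7.2.6] -/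
theorem h3s_isotope_bounds :
    0.36 < isotopeExp (1 / 1.4) ((Real.pi * 170 / 450) ^ 2) ∧
      isotopeExp (1 / 1.4) ((Real.pi * 170 / 450) ^ 2) < 0.37 ∧
      0.33 < kresinIsotope (2 / 3) ((Real.pi * 170 / 450) ^ 2) ∧
      kresinIsotope (2 / 3) ((Real.pi * 170 / 450) ^ 2) < 0.34 := by
  have hπ1 := Real.pi_gt_d2
  have hπ2 := Real.pi_lt_d2
  set x := (Real.pi * 170 / 450) ^ 2 with hx
  have hx1 : 1.40 < x := by rw [hx]; nlinarith
  have hx2 : x < 1.42 := by rw [hx]; nlinarith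
  have hprod : 0 < (x - 1.40) * (1.42 - x) := mul_pos (by linarith) (by linarith)
  unfold isotopeExp kresinIsotope
  have hD1 : 0 < (1 + x) * (1 + x + 1 / 1.4) := by positivity
  have hD2 : 0 < (1 + x) ^ 2 := by positivity
  refine ⟨?_, ?_, ?_, ?_⟩
  · have h : 2 * (1 / 1.4) * x / ((1 + x) * (1 + x + 1 / 1.4)) < 0.28 := by
      rw [div_lt_iff₀ hD1]; nlinarith
    linarith
  · have h : 0.26 < 2 * (1 / 1.4) * x / ((1 + x) * (1 + x + 1 / 1.4)) := by
      rw [lt_div_iff₀ hD1]; nlinarith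
    linarith
  · have h : 2 * (2 / 3) * x / (1 + x) ^ 2 < 0.34 := by
      rw [div_lt_iff₀ hD2]; nlinarith [sq_nonneg (x - 1)]
    linarith
  · have h : 0.32 < 2 * (2 / 3) * x / (1 + x) ^ 2 := by
      rw [lt_div_iff₀ hD2]; nlinarith
    linarith

end TwoCoupling

end Literature.MathematicalPhysics.QuantumManyBody

end
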